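import Summits.QuantumFields.BalabanUV.Beta.D1BFx.SplitInstance

/-!
# `BalabanUV.Beta.D1BFx.SplitPackaged` — road «BF-x» for binder row D1, slot (SPLIT): `SplitInstance.split_at_basePoint` PACKAGED IN THE LITERAL SHAPE OF
# `D1BFx/Assembly`'s `hsplit` — pieces `ι := Fin 2` (gluon, ghost), weights ∕ integrands ∕ REST words as functions of the block size `n` (junk `0` at `n = 0`),
# base points `b ∈ image resSite`, profile `g := gp n b` per base site — for all `n ≥ 2` at once

HONEST DEPENDENCY (page 1, mandatory): continuum YM on T⁴ ⇐ BetaPertH ∧ nine spine estimates (0/9 proved); BetaPertH ⇐ (D1) ∧ (D4) ∧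
CAP+tail; G-an2-4 gates asym, D1 and NE2/3/4.  HONEST FRAMING (cell contract, verbatim): «discharging `BetaPertH` makes Bałaban's UV
stability UNCONDITIONAL — a real constructive-QFT result; it is NOT the continuum limit and NOT the Clay problem.»  THIS MODULE DISCHARGES
NOTHING of the wall: [folklore] `dite` packaging of `SplitInstance.split_at_basePoint`; THREE definitions with bodies ([our objects] `ωPk`, `KfPk`, `KrPk` —
the slot data of `Assembly` for the two landed fine-loop pieces as functions of `n`; assert nothing).  No `Prop` minted, nothing printed asserted, 0 sorry.
0 wall binders; NOT D1, NOT `BetaPertH`, NOT continuum, NOT Clay.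

ABSOLUTE RULE (cell charter, verbatim): «No internally-minted statement may enter as a cited fact. Every hypothesis is either kernel-proved in
this package or a verbatim quotation of a PUBLISHED theorem with page reference. The manuscript(s) under audit are NOT citable for their own
disputed steps — they are the thing under adjudication; programme-internal (2001/route/tribunal) claims are never citable.»

WHY (`SPLIT-SPEC.md` v1.1 §4 «n-PACKAGING, owner»).  `Assembly.defect_eq_of_slots` ∕ `hT_of_slots` quantify `∀ n ≥ 2, ∀ b ∈ Bset n, ∀ w` over plain functions
of `n`; the road's objects (`fineHess n a …`, `fineHessGhQ n a …`, `restK n a …`) need `[NeZero n]`.  As in `FirstStepLargeBlock.shotCoeff`, the slot data are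
defined by `if h : 1 ≤ n then … else 0` with the instance supplied inside; for `n ≥ 2` the `dite` opens and `split_at_basePoint` applies verbatim.  Every
road parameter may depend on `n` (the colour weights carry block-size powers — CHECK-N0's exponent socket; the second-order tables are at blocking `n`);
the frozen profile is `gp n b` (R-10′'s `gfrz n a b`, sub-leaf 5d-leg).
* §1 [our objects] `ωPk`, `KfPk` (`0 ↦` gluon (F)-integrand, `1 ↦` ghost), `KrPk`; unfoldings at `1 ≤ n`.
* §2 **`hsplit_packaged`**: under the per-`n` hypotheses of `split_at_basePoint` (for every `n ≥ 2` and every base site): `∀ n ≥ 2, ∀ b ∈ image resSite, ∀ w,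
  Σ_{i : Fin 2} ωPk i n · KfPk … i n b w = stK μ ν N (gp n b) w + Σ_{τ : RestIdx} KrPk … τ n b w` — LITERALLY the `hsplit` binder of `D1BFx/Assembly` with
  `ι := Fin 2`, `T := RestIdx`, `κB := Pt`, `Bset n := image resSite`, `Gf := gp`.
Unit `b2b-balaban-beta-d1-p2` (road owner, gen 2); `LEAVES-BFx.md` rows A1.ii ∕ A0 ∕ A7.
-/

open Finset
open scoped BigOperators
open Literature.MathematicalPhysics.QuantumFieldTheory.Balaban1983to89
open Literature.MathematicalPhysics.QuantumFieldTheory.Balaban1983to89.Beta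
open B12Sec2to5 (l1)
open ExpKernelCalculus (Site MKer)
open DyadicShell (Pt toReal)
open SquareTable (stK)
open DressedMomentNormalisation (resSite)
open Summit.QuantumFields.BalabanUV.Beta.TameKernelCalculus (Spr Loc)
open Summit.QuantumFields.BalabanUV.Beta.D1BFx.MomentTransferPeriodic (baseKer)
open Summit.QuantumFields.BalabanUV.Beta.D1BFx.GluonLeg (Ga)
open Summit.QuantumFields.BalabanUV.Beta.D1BFx.ReducedKernel (TableR)
open Summit.QuantumFields.BalabanUV.Beta.D1BFx.ReducedKernelSandwich (fineHess)
open Summit.QuantumFields.BalabanUV.Beta.D1BFx.FineStencilBFBalaban (SbfBal)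
open Summit.QuantumFields.BalabanUV.Beta.D1BFx.SecondStencilBF (Wbf)
open Summit.QuantumFields.BalabanUV.Beta.D1BFx.GhostKernelComplete (fineHessGhQ)
open Summit.QuantumFields.BalabanUV.Beta.D1BFx.SplitInstance (RestIdx restK split_at_basePoint)

namespace Summit.QuantumFields.BalabanUV.Beta.D1BFx.SplitPackaged

/-! ## §1 The slot data as functions of the block size -/

section Data

variable (a : ℝ) (gp : ℕ → Pt → Pt → ℝ) (cE cVH cΛ cR cK cQ cE₂ cJ4 cΛ₂ cR₂ cQ₂ x₀ : ℕ → ℝ) (WE WJ WΛ WR WQ : ℕ → TableR)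
  (ωgl ωgh lam : ℕ → ℝ) (N : ℝ) (μ ν : Fin 4)

/-- [our object] THE PIECE WEIGHTS as a `Fin 2`-family: `0 ↦ ω_gl n`, `1 ↦ ω_gh n`.  A DEFINITION. -/
def ωPk (ωgl ωgh : ℕ → ℝ) : Fin 2 → ℕ → ℝ := fun i n => if i = 0 then ωgl n else ωgh n

/-- [our object] THE (F)-INTEGRANDS of the two fine-loop pieces as functions of `n` (junk `0` at `n = 0`): `0 ↦ n⁻⁸·w_μw_ν·baseKer (fineHess n a SbfBal Wbf μ ν) b w`,
`1 ↦ n⁻⁸·w_μw_ν·baseKer (fineHessGhQ n a x₀ cK cQ μ ν) b w`.  A DEFINITION; asserts nothing. -/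
noncomputable def KfPk : Fin 2 → ℕ → Pt → Pt → ℝ := fun i n b w =>
  if h : 1 ≤ n then
    haveI : NeZero n := ⟨Nat.one_le_iff_ne_zero.mp h⟩
    if i = 0 then
      ((n : ℝ) ^ 8)⁻¹ * (toReal w μ * toReal w ν *
        baseKer (fineHess n a (SbfBal n a (cE n) (cVH n) (cΛ n) (cR n) (cK n) (cQ n))
          (Wbf (cE₂ n) (cJ4 n) (cΛ₂ n) (cR₂ n) (cQ₂ n) (WE n) (WJ n) (WΛ n) (WR n) (WQ n)) μ ν) b w)
    else
      ((n : ℝ) ^ 8)⁻¹ * (toReal w μ * toReal w ν * baseKer (fineHessGhQ n a (x₀ n) (cK n) (cQ n) μ ν) b w)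
  else 0

/-- [our object] THE REST WORDS as functions of `n` (junk `0` at `n = 0`): `SplitInstance.restK` at the frozen profile `gp n b`.  A DEFINITION. -/
noncomputable def KrPk : RestIdx → ℕ → Pt → Pt → ℝ := fun τ n b w =>
  if h : 1 ≤ n then
    haveI : NeZero n := ⟨Nat.one_le_iff_ne_zero.mp h⟩
    restK n a (gp n b) (cE n) (cΛ n) (cR n) (cK n) (cQ n) (cE₂ n) (cJ4 n) (cΛ₂ n) (cR₂ n) (cQ₂ n) (x₀ n) (WE n) (WJ n) (WΛ n) (WR n) (WQ n)
      (ωgl n) (ωgh n) (lam n) N μ ν b τ w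
  else 0

end Data

/-! ## §2 The packaged (SPLIT) binder -/

section Packaged

variable {a : ℝ} {gp : ℕ → Pt → Pt → ℝ} {cE cVH cΛ cR cK cQ cE₂ cJ4 cΛ₂ cR₂ cQ₂ x₀ : ℕ → ℝ} {WE WJ WΛ WR WQ : ℕ → TableR}
  {ωgl ωgh lam : ℕ → ℝ} {N : ℝ} {μ ν : Fin 4}

/-- [folklore] **THE (SPLIT) BINDER OF `D1BFx/Assembly`, PACKAGED**: for every `n ≥ 2`, every base site `b ∈ image resSite` and every `w`,
`Σ_{i : Fin 2} ωPk i n · KfPk … i n b w = stK μ ν N (gp n b) w + Σ_{τ : RestIdx} KrPk … τ n b w` — given, for every such `n` and `b`, the hypotheses of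
`SplitInstance.split_at_basePoint` (`0 < a`; `Spr (Ga n a)`; an exponential bound and evenness for the profile `gp n b`; `Loc` of the five slot tables at `n`;
`μ ≠ ν`; the loop-weight ratio and normalisation at `n`). -/
theorem hsplit_packaged (ha : 0 < a) (hGa : ∀ n : ℕ, 2 ≤ n → ∀ [NeZero n], Spr (Ga n a))
    (hg : ∀ n : ℕ, 2 ≤ n → ∀ b : Pt, ∃ C δ : ℝ, 0 < δ ∧ ∀ v, |gp n b v| ≤ C * Real.exp (-δ * l1 v))
    (hgev : ∀ n : ℕ, 2 ≤ n → ∀ b w : Pt, gp n b (-w) = gp n b w)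
    (hE : ∀ n κ u l u', Loc (WE n κ u l u')) (hJ : ∀ n κ u l u', Loc (WJ n κ u l u')) (hΛ : ∀ n κ u l u', Loc (WΛ n κ u l u'))
    (hR : ∀ n κ u l u', Loc (WR n κ u l u')) (hQ : ∀ n κ u l u', Loc (WQ n κ u l u')) (hμν : μ ≠ ν)
    (hω : ∀ n : ℕ, 2 ≤ n → ωgh n * cK n ^ 2 = -2 * (ωgl n * cE n ^ 2)) (hlam : ∀ n : ℕ, 2 ≤ n → ωgl n * cE n ^ 2 = 2 * N ^ 2 * lam n) :
    ∀ n : ℕ, 2 ≤ n → ∀ b ∈ (univ : Finset (Fin 4 → Fin n)).image resSite, ∀ w : Pt,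
      (∑ i : Fin 2, ωPk ωgl ωgh i n * KfPk a cE cVH cΛ cR cK cQ cE₂ cJ4 cΛ₂ cR₂ cQ₂ x₀ WE WJ WΛ WR WQ μ ν i n b w) =
        stK μ ν N (gp n b) w
          + ∑ τ : RestIdx, KrPk a gp cE cΛ cR cK cQ cE₂ cJ4 cΛ₂ cR₂ cQ₂ x₀ WE WJ WΛ WR WQ ωgl ωgh lam N μ ν τ n b w := by
  intro n hn b _ w
  have h1 : 1 ≤ n := le_trans one_le_two hn
  haveI : NeZero n := ⟨Nat.one_le_iff_ne_zero.mp h1⟩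
  obtain ⟨C, δ, hδ, hgb⟩ := hg n hn b
  rw [Fin.sum_univ_two]
  simp only [ωPk, KfPk, KrPk, dif_pos h1, if_true, Fin.isValue, one_ne_zero, if_false]
  exact split_at_basePoint n a (cE n) (cVH n) (cΛ n) (cR n) (cK n) (cQ n) (cE₂ n) (cJ4 n) (cΛ₂ n) (cR₂ n) (cQ₂ n) (x₀ n) (WE n) (WJ n) (WΛ n)
    (WR n) (WQ n) ha (hGa n hn) hδ hgb (hgev n hn b) (hE n) (hJ n) (hΛ n) (hR n) (hQ n) hμν (hω n hn) (hlam n hn) b w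

end Packaged

end Summit.QuantumFields.BalabanUV.Beta.D1BFx.SplitPackaged
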